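import Summits.QuantumFields.YangMills.Theorems.BalabanUVNodesN16KingModelFibreTranslate
import Summits.QuantumFields.YangMills.Theorems.BalabanUVNodesN16KingModelTwoRunDeriv

/-!
# Route «BalabanUVNodes» (K3⁵ `SpineGivenEndpointR13SepCoP`), DAG node N16 = NE3 — THE KING-MODEL RUNG OF NE3, HÖLDER LINE,
# PART 2: the HÖLDER QUOTIENT `|x − y|^{−α}(D(x) − D(y))` of the two-run minimiser discrepancy `D = φ_k^ψ − Q_nφ_{k+n}^ψ` (run A's
# minimiser vs run B's minimiser block-averaged back) has King's GEOMETRIC RATE with ONE level-free (and volume-free) constant —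
# King 1986 Prop. 3.8 (3.71) line 3 + Thm 3.3 (3.8), BY NAME — the scalar template of this seat's Hölder root `CovRootHolder β`

Cell `pub-ymgap`, seat `pub-ymgap-dag-n16-c` (R134 acceleration seat, strategy s1; HUMAN RULING D-0062; chair R424 venue), generation 8.
`--kind proof --supports stmt-QuantumFields-20296 --as helper` (K3⁵, plan g68 KEY-20 ∕ dag-lead WORDS-141).  `bears_on: R4∕N16 · row «R2^ϱ,
the unprinted core»`.

WHY THIS FILE.  The chain of record of node N16 reads, from N05's leaf, the (1.36)₃ HÖLDER member of [Balaban1985RegularSpaces] Thm 4's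
output at the minimiser pair, and generations 2–4 of this seat re-typed N16's root accordingly (`N16HolderDefs.CovRootHolder β`: the
two-run discrepancy direction `Z` is Hölder-`β` with the geometric rate; `N16HolderMSDefs.CovRootHolderMS β`; NE7's consumer END
`closeness_of_covRoot_holder(MS)`).  In King's `A = 0` scalar model the corresponding statement is PRINTED AND PROVED: Prop. 3.8 (3.71)
LINE 3, the Hölder quotient of the two-spacing discrepancy, typed by seat n18-b for the ACTUAL operators (`MinimizerTwoSpacingHolder.
king_prop38_holder_torus`, every torus; `MinimizerHolderDecay.king_prop38_holder_torus_blocks`, Bałaban's volumes with Thm 3.3's decay) and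
made level-free by seat n18-a (`N18KingModelScalesPair.fprop38Const_le_unif`, `sqrt_rate_le_unif`).  THIS file reads it for the
BLOCK-AVERAGED discrepancy `D` at an arbitrary pair of coarse points `(x, x + v)`: PART 1 (`N16KingModelTranslate`) pairs each fine point
`x′` over `x` with its translate `x′ + Lⁿ·v` over `x + v` (`overFib_translate_eq_map`), whose unit-coordinate distance EQUALS that of
`(x, x + v)` (`holdist_translate`), so King's line 3 applies term by term with one Hölder weight — no dichotomy, no Hölder patch.

WHAT THIS FILE PROVES (kernel; theorems only — 0 `def`, 0 sorry; `ℋ_k = minimiser Lᵏ M a_k (Lᵏ)² m²` King's ACTUAL operator, fibre and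
block mean spelled INLINE as in generation 7; `ρ = holdist Lᵏ M x (x + v)` the sup torus distance in unit coordinates):
* §1 ★ `twoRunHolder_kernel_blockMean_le` — EVERY volume `M`, odd `L ≥ 2`, `k, n ≥ 1`, `a, m² > 0`, `0 ≤ α`, `0 < γ`, `α + γ ≤ 1`, every
  `b, x, v`: `|ρ^{−α}·(D_b(x) − D_b(x + v))| ≤ C₅″(a, L, d, γ, α)·(L^{−γ})^k`, `D_b = ℋ_k(·, b) − Q_nℋ_{k+n}(·, b)`,
  `C₅″ = fprop38RateConst a a Θ (π²∕4)^d d γ α (2d^α) 0 + fprop38PosConst a (π²∕4)^d d γ α (2d^α) (6d^{α+γ})` (n18-a's uniform constant);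
  ★ `twoRunHolder_minimiser_blockMean_le_l1` — the datum form `|ρ^{−α}·(D^ψ(x) − D^ψ(x + v))| ≤ C₅″·(L^{−γ})^k·Σ_b|ψ(b)|`.
* §2 ★★ `twoRunHolder_minimiser_blockMean_le_sup` — on BAŁABAN's VOLUMES (`M_μ = 2Lᵐ`), `0 < α`, `0 < γ`, `α + γ ≤ 1`: there are `δ, c > 0`
  (functions of `d, L, a, m², α` only; n18-b's `king_prop38_holder_torus_blocks`) with, for EVERY volume `P = (d, L, m, K)`, `K ≥ 1`, every
  `n ≥ 1`, datum `|ψ| ≤ S`, coarse points `x, x + v`: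
  `|ρ^{−α}·(D^ψ(x) − D^ψ(x + v))| ≤ 2√(2c·C₅″)·K_d(δ∕2)·(L^{−γ∕2})^K·S` — UNCONDITIONAL, ONE constant for ALL levels, all `n`, all volumes.

READING FOR ROW N16 (a dictionary, NOT a decl): `CovRootHolder β`'s Hölder member «`‖Z(x) − Ad(…)Z(y)‖ ≤ B_h·|x − y|^β·(rate)^k`» ↔
`|D(x) − D(x + v)| ≤ C·ρ^α·(L^{−γ∕2})^K·S` (abelian: `Ad = id`; `α` plays `β`); together with generation 7's VALUE line and generation 8's
DERIVATIVE line, ALL THREE printed currencies of the two-run discrepancy (sup, lattice derivative, Hölder quotient) now hold in kernel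
for `D` with King's rate.  NOT CARRIED: the gauge `u`, the transport, the covariant block average, Bałaban's axial constraint.

HONEST FRAMING.  A MODEL LAYER (template literature: [King1986] is printed AND proved; re-proved here in kernel from the tree's King files
BY NAME).  NOTHING of [Balaban1985RegularSpaces] ∕ [Balaban1985Variational] is proved or discharged; N16 ∕ NE3 is NOT discharged (in-edges
N05 — [B8] Thm 4 ∕ Prop 3 at the pinned all-torus members — and N07 — [B11] Thm 1 (8)+(10) — remain hypotheses of the chain of record);
COUNT UNMOVED; count-neutral; one finite torus at a time — NOT ℝ⁴, NOT infinite volume, NOT OS, NOT a mass gap, NOT Clay.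

Sources: C. King, *The U(1) Higgs model. I. The continuum limit*, Commun. Math. Phys. **102** (1986) 649–677 [King1986], Prop. 3.8
(3.71) p. 664 (line 3), (3.62) p. 663, Thm 3.3 (3.8) p. 658, Prop. 3.7 (3.65) p. 663, (4.19), (4.26)–(4.28) pp. 672–673, p. 674;
T. Bałaban, *Regularity and decay of lattice Green's functions*, Commun. Math. Phys. **89** (1983) 571–597 [Balaban1983RegularityDecay],
Thm (1.10) p. 573 («see [Ba 4]» for (3.8)).
-/

set_option autoImplicit false

noncomputable section

open Real Finset
open scoped BigOperators

namespace Summit.QuantumFields.YangMills.BalabanUVNodes.N16KingModelHolder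

open Literature.MathematicalPhysics.QuantumFieldTheory.Balaban1983to89 (Params)
open Literature.MathematicalPhysics.QuantumFieldTheory.Balaban1983to89.B5Prop11Plancherel (Tor fine)
open Literature.MathematicalPhysics.QuantumFieldTheory.Balaban1983to89.B4Sect5Proof (latticeConst latticeConst_nonneg)
open Literature.MathematicalPhysics.QuantumFieldTheory.King1986
  (aK lemma43Const fprop38RateConst fprop38PosConst aliasConst)
open Literature.MathematicalPhysics.QuantumFieldTheory.King1986.Torus
  (minimiser blockOf tdistT tdistT_sumBound holdist king_prop38_holder_torus king_prop38_holder_torus_blocks)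
open Summit.QuantumFields.YangMills.BalabanUVNodes.N18KingModel (rpow_neg_natPow kingTheta_pos)
open Summit.QuantumFields.YangMills.BalabanUVNodes.N18KingModelScalesPair
  (fprop38Const_le_unif sqrt_rate_le_unif aliasConst_nonneg_of_lt_one)
open Summit.QuantumFields.YangMills.BalabanUVNodes.N16KingModel (mem_overFib overFib_nonempty abs_blockMean_sub_le)
open Summit.QuantumFields.YangMills.BalabanUVNodes.N16KingModelTranslate
  (over_add_translate blockMean_translate blockMean_mul_sub holdist_translate)
open Summit.QuantumFields.YangMills.BalabanUVNodes.N16KingModelDeriv (exp_neg_mul_min_le datum_expand)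

variable {d : ℕ}

/-! ## §1 ★ EVERY VOLUME: the Hölder quotient of the two-run kernel ∕ minimiser discrepancy after block averaging -/

section EveryVolume

variable {L : ℕ} [NeZero L] (M : Fin d → ℕ) [∀ μ, NeZero (M μ)]

/-- ★ **THE HÖLDER QUOTIENT OF THE TWO-RUN KERNEL DISCREPANCY AFTER BLOCK AVERAGING** (every volume `M`, odd `L ≥ 2`, `k, n ≥ 1`, `a, m² > 0`,
`0 ≤ α`, `0 < γ`, `α + γ ≤ 1`): with `D_b(z) = ℋ_k(z, b) − (Q_nℋ_{k+n}(·, b))(z)` and `ρ = holdist Lᵏ M x (x + v)` (sup torus distance of the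
coarse pair in unit coordinates), for every `b, x, v`: `|ρ^{−α}·(D_b(x) − D_b(x + v))| ≤ C₅″(a, L, d, γ, α)·(L^{−γ})^k`.  Proof: PART 1 pairs
each `x′` over `x` with `x′ + Lⁿ·v` over `x + v` (`blockMean_translate`) at the SAME unit distance (`holdist_translate`); King's (3.71) line 3
`king_prop38_holder_torus` bounds each term; `abs_blockMean_sub_le` averages; `fprop38Const_le_unif` removes the `k, n`-dependence.
[cite: King1986, Prop. 3.8 (3.71) p.664 (line 3), (3.62) p.663, (4.26)–(4.28) pp.672–673] -/
theorem twoRunHolder_kernel_blockMean_le (hd : 0 < d) (hLodd : Odd L) (hL : 2 ≤ L) {k n : ℕ} (hk : 1 ≤ k) (hn : 1 ≤ n)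
    {a m2 : ℝ} (ha : 0 < a) (hm : 0 < m2) {α γ : ℝ} (hα : 0 ≤ α) (hγ : 0 < γ) (hαγ : α + γ ≤ 1) (b : Tor M)
    (x v : Tor (fine (L ^ k) M)) :
    |(holdist (L ^ k) M x (x + v)) ^ (-α) *
        ((minimiser (L ^ k) M (aK a L k) (((L ^ k : ℕ) : ℝ) ^ 2) m2 (Pi.single b 1) x
            - (((Finset.univ.filter fun x' : Tor (fine (L ^ n * L ^ k) M) =>
                  ∀ ν, (x ν).val = (x' ν).val / L ^ n).card : ℝ))⁻¹ *
              ∑ x' ∈ (Finset.univ.filter fun x' : Tor (fine (L ^ n * L ^ k) M) => ∀ ν, (x ν).val = (x' ν).val / L ^ n),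
                minimiser (L ^ n * L ^ k) M (aK a L (k + n)) (((L ^ n * L ^ k : ℕ) : ℝ) ^ 2) m2 (Pi.single b 1) x')
          - (minimiser (L ^ k) M (aK a L k) (((L ^ k : ℕ) : ℝ) ^ 2) m2 (Pi.single b 1) (x + v)
            - (((Finset.univ.filter fun y : Tor (fine (L ^ n * L ^ k) M) =>
                  ∀ ν, ((x + v) ν).val = (y ν).val / L ^ n).card : ℝ))⁻¹ *
              ∑ y ∈ (Finset.univ.filter fun y : Tor (fine (L ^ n * L ^ k) M) => ∀ ν, ((x + v) ν).val = (y ν).val / L ^ n),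
                minimiser (L ^ n * L ^ k) M (aK a L (k + n)) (((L ^ n * L ^ k : ℕ) : ℝ) ^ 2) m2 (Pi.single b 1) y))|
      ≤ (fprop38RateConst a a (a * (2 * ((a * (1 - ((L : ℝ) ^ 2)⁻¹))⁻¹ + π ^ 2 / 48 + 1 / 3))) ((π ^ 2 / 4) ^ d) d γ α
            (2 * (d : ℝ) ^ α) 0
          + fprop38PosConst a ((π ^ 2 / 4) ^ d) d γ α (2 * (d : ℝ) ^ α) (6 * (d : ℝ) ^ (α + γ))) * ((L : ℝ) ^ (-γ)) ^ k := by
  have hr : 0 ≤ ((L ^ k : ℕ) : ℝ) ^ (-γ) := Real.rpow_nonneg (Nat.cast_nonneg _) _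
  have hAC : 0 ≤ aliasConst d (α + γ - 1) := aliasConst_nonneg_of_lt_one hd (by linarith)
  have hCle := fprop38Const_le_unif (d := d) ha hL hk hn (V := (π ^ 2 / 4) ^ d) (γ := γ) (β := α)
    (cE := 2 * (d : ℝ) ^ α) (rE := 0) (sE := 6 * (d : ℝ) ^ (α + γ)) (by positivity) (by positivity) hAC
  -- King's line 3 at the translated pairs, averaged over the fibre of `x`
  have key := abs_blockMean_sub_le (overFib_nonempty (by omega) k n M x)
    (f := fun x' : Tor (fine (L ^ n * L ^ k) M) => (holdist (L ^ k) M x (x + v)) ^ (-α) *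
      (minimiser (L ^ n * L ^ k) M (aK a L (k + n)) (((L ^ n * L ^ k : ℕ) : ℝ) ^ 2) m2 (Pi.single b 1) x'
        - minimiser (L ^ n * L ^ k) M (aK a L (k + n)) (((L ^ n * L ^ k : ℕ) : ℝ) ^ 2) m2 (Pi.single b 1)
          (x' + fun ν => (((v ν).val * L ^ n : ℕ) : ZMod (fine (L ^ n * L ^ k) M ν)))))
    (t := (holdist (L ^ k) M x (x + v)) ^ (-α) *
      (minimiser (L ^ k) M (aK a L k) (((L ^ k : ℕ) : ℝ) ^ 2) m2 (Pi.single b 1) x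
        - minimiser (L ^ k) M (aK a L k) (((L ^ k : ℕ) : ℝ) ^ 2) m2 (Pi.single b 1) (x + v)))
    (C := (fprop38RateConst a a (lemma43Const a L k n) ((π ^ 2 / 4) ^ d) d γ α (2 * (d : ℝ) ^ α) 0
      + fprop38PosConst a ((π ^ 2 / 4) ^ d) d γ α (2 * (d : ℝ) ^ α) (6 * (d : ℝ) ^ (α + γ))) * ((L ^ k : ℕ) : ℝ) ^ (-γ))
    (fun x' hx' => by
      have hx := mem_overFib.1 hx'
      have h := king_prop38_holder_torus hd hLodd hL hk hn M ha hm hα hγ hαγ b x (x + v) x' _ hx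
        (over_add_translate x x' hx v)
      rwa [holdist_translate] at h)
  rw [blockMean_mul_sub, abs_sub_comm] at key
  have hrew : ∀ w Ax Q0 Ay Q1 : ℝ, w * ((Ax - Q0) - (Ay - Q1)) = w * (Ax - Ay) - w * (Q0 - Q1) := by intros; ring
  rw [hrew, blockMean_translate x v
    (minimiser (L ^ n * L ^ k) M (aK a L (k + n)) (((L ^ n * L ^ k : ℕ) : ℝ) ^ 2) m2 (Pi.single b 1))]
  refine key.trans ?_
  rw [rpow_neg_natPow]
  exact mul_le_mul_of_nonneg_right hCle (pow_nonneg (kingTheta_pos (by omega) γ).le k)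

/-- ★ **THE HÖLDER QUOTIENT OF THE TWO-RUN MINIMISER DISCREPANCY AFTER BLOCK AVERAGING — DATUM FORM, EVERY VOLUME**: for every datum `ψ`,
coarse points `x, x + v`: `|ρ^{−α}·(D^ψ(x) − D^ψ(x + v))| ≤ C₅″·(L^{−γ})^k·Σ_b|ψ(b)|`, `D^ψ = φ_k^ψ − Q_nφ_{k+n}^ψ` — linearity in the datum
(`N16KingModelDeriv.datum_expand`) over `twoRunHolder_kernel_blockMean_le`.  `CovRootHolder`'s Hölder member IN KING's MODEL, `ℓ¹`-datum form.
[cite: King1986, Prop. 3.8 (3.71) p.664, (2.13)–(2.15) p.653] -/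
theorem twoRunHolder_minimiser_blockMean_le_l1 (hd : 0 < d) (hLodd : Odd L) (hL : 2 ≤ L) {k n : ℕ} (hk : 1 ≤ k) (hn : 1 ≤ n)
    {a m2 : ℝ} (ha : 0 < a) (hm : 0 < m2) {α γ : ℝ} (hα : 0 ≤ α) (hγ : 0 < γ) (hαγ : α + γ ≤ 1) (ψ : Tor M → ℝ)
    (x v : Tor (fine (L ^ k) M)) :
    |(holdist (L ^ k) M x (x + v)) ^ (-α) *
        ((minimiser (L ^ k) M (aK a L k) (((L ^ k : ℕ) : ℝ) ^ 2) m2 ψ x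
            - (((Finset.univ.filter fun x' : Tor (fine (L ^ n * L ^ k) M) =>
                  ∀ ν, (x ν).val = (x' ν).val / L ^ n).card : ℝ))⁻¹ *
              ∑ x' ∈ (Finset.univ.filter fun x' : Tor (fine (L ^ n * L ^ k) M) => ∀ ν, (x ν).val = (x' ν).val / L ^ n),
                minimiser (L ^ n * L ^ k) M (aK a L (k + n)) (((L ^ n * L ^ k : ℕ) : ℝ) ^ 2) m2 ψ x')
          - (minimiser (L ^ k) M (aK a L k) (((L ^ k : ℕ) : ℝ) ^ 2) m2 ψ (x + v)
            - (((Finset.univ.filter fun y : Tor (fine (L ^ n * L ^ k) M) =>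
                  ∀ ν, ((x + v) ν).val = (y ν).val / L ^ n).card : ℝ))⁻¹ *
              ∑ y ∈ (Finset.univ.filter fun y : Tor (fine (L ^ n * L ^ k) M) => ∀ ν, ((x + v) ν).val = (y ν).val / L ^ n),
                minimiser (L ^ n * L ^ k) M (aK a L (k + n)) (((L ^ n * L ^ k : ℕ) : ℝ) ^ 2) m2 ψ y))|
      ≤ (fprop38RateConst a a (a * (2 * ((a * (1 - ((L : ℝ) ^ 2)⁻¹))⁻¹ + π ^ 2 / 48 + 1 / 3))) ((π ^ 2 / 4) ^ d) d γ α
            (2 * (d : ℝ) ^ α) 0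
          + fprop38PosConst a ((π ^ 2 / 4) ^ d) d γ α (2 * (d : ℝ) ^ α) (6 * (d : ℝ) ^ (α + γ))) * ((L : ℝ) ^ (-γ)) ^ k
        * ∑ b, |ψ b| := by
  set C : ℝ := (fprop38RateConst a a (a * (2 * ((a * (1 - ((L : ℝ) ^ 2)⁻¹))⁻¹ + π ^ 2 / 48 + 1 / 3))) ((π ^ 2 / 4) ^ d) d γ α
            (2 * (d : ℝ) ^ α) 0
          + fprop38PosConst a ((π ^ 2 / 4) ^ d) d γ α (2 * (d : ℝ) ^ α) (6 * (d : ℝ) ^ (α + γ))) * ((L : ℝ) ^ (-γ)) ^ k with hC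
  rw [datum_expand]
  calc _ ≤ ∑ b, |ψ b * ((holdist (L ^ k) M x (x + v)) ^ (-α) *
          ((minimiser (L ^ k) M (aK a L k) (((L ^ k : ℕ) : ℝ) ^ 2) m2 (Pi.single b 1) x
              - (((Finset.univ.filter fun x' : Tor (fine (L ^ n * L ^ k) M) =>
                    ∀ ν, (x ν).val = (x' ν).val / L ^ n).card : ℝ))⁻¹ *
                ∑ x' ∈ (Finset.univ.filter fun x' : Tor (fine (L ^ n * L ^ k) M) => ∀ ν, (x ν).val = (x' ν).val / L ^ n),
                  minimiser (L ^ n * L ^ k) M (aK a L (k + n)) (((L ^ n * L ^ k : ℕ) : ℝ) ^ 2) m2 (Pi.single b 1) x')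
            - (minimiser (L ^ k) M (aK a L k) (((L ^ k : ℕ) : ℝ) ^ 2) m2 (Pi.single b 1) (x + v)
              - (((Finset.univ.filter fun y : Tor (fine (L ^ n * L ^ k) M) =>
                    ∀ ν, ((x + v) ν).val = (y ν).val / L ^ n).card : ℝ))⁻¹ *
                ∑ y ∈ (Finset.univ.filter fun y : Tor (fine (L ^ n * L ^ k) M) =>
                    ∀ ν, ((x + v) ν).val = (y ν).val / L ^ n),
                  minimiser (L ^ n * L ^ k) M (aK a L (k + n)) (((L ^ n * L ^ k : ℕ) : ℝ) ^ 2) m2 (Pi.single b 1) y)))| :=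
        Finset.abs_sum_le_sum_abs _ _
    _ ≤ ∑ b, |ψ b| * C := by
        refine Finset.sum_le_sum fun b _ => ?_
        rw [abs_mul]
        exact mul_le_mul_of_nonneg_left
          (twoRunHolder_kernel_blockMean_le M hd hLodd hL hk hn ha hm hα hγ hαγ b x v) (abs_nonneg _)
    _ = C * ∑ b, |ψ b| := by rw [← Finset.sum_mul, mul_comm]

end EveryVolume

/-! ## §2 ★★ On Bałaban's volumes: the SUP-NORM Hölder quotient of the two-run discrepancy with King's decay — level- AND volume-free -/

/-- ★★ **`CovRootHolder`'s HÖLDER MEMBER IN KING's MODEL, SUP-NORM FORM, UNCONDITIONAL** (King's Prop. 3.8 (3.71) line 3 «combined with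
Theorem 3.3», at the translated fine pairs, averaged over the fibre, summed over the unit torus).  For `d ≥ 1`, odd `L ≥ 2`, `a, m² > 0`,
`0 < α`, `0 < γ`, `α + γ ≤ 1` there are `δ, c > 0` (functions of `d, L, a, m², α` only — n18-b's `king_prop38_holder_torus_blocks`) such that
for EVERY volume `P = (d, L, m, K)` of the `B1∕B4` tower with `K ≥ 1` (unit torus `M_μ = 2Lᵐ`), every `n ≥ 1`, every datum `ψ` with `|ψ| ≤ S`
and every pair of coarse points `x, x + v`, with `ρ = holdist L^K M x (x + v)` and `D^ψ = φ_K^ψ − Q_nφ_{K+n}^ψ`: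
`|ρ^{−α}·(D^ψ(x) − D^ψ(x + v))| ≤ 2√(2c·C₅″(a, L, d, γ, α))·K_d(δ∕2)·(L^{−γ∕2})^K·S`, `K_d = B4Sect5Proof.latticeConst d` (`tdistT_sumBound`;
the factor `2` = the two decay profiles around `B(x)` and `B(x + v)` of King's `exp[−δ₀dist({x, y}, z)]`).  The constant reads NEITHER the
level `K` NOR `n` NOR the volume. [cite: King1986, Prop. 3.8 (3.71) p.664 (line 3), Thm 3.3 (3.8) p.658, p.674;
Balaban1983RegularityDecay, Thm (1.10) p.573] -/
theorem twoRunHolder_minimiser_blockMean_le_sup (dd L : ℕ) (hd : 1 ≤ dd) (hLodd : Odd L) (hL : 2 ≤ L) {a m2 : ℝ} (ha : 0 < a)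
    (hm : 0 < m2) {α γ : ℝ} (hα : 0 < α) (hγ : 0 < γ) (hαγ : α + γ ≤ 1) :
    ∃ δ c : ℝ, 0 < δ ∧ 0 < c ∧
      ∀ (P : Params) (_hPd : P.d = dd) (_hPL : P.L = L) (_hK : 1 ≤ P.K) [NeZero P.L]
      (n : ℕ) (_hn : 1 ≤ n) (M : Fin P.d → ℕ) [∀ μ, NeZero (M μ)] (_hMK : ∀ μ, M μ = P.sitesPerDir P.K)
      (ψ : Tor M → ℝ) (S : ℝ) (_hS : ∀ b, |ψ b| ≤ S) (xt v : Tor (fine (P.L ^ P.K) M)),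
      |(holdist (P.L ^ P.K) M xt (xt + v)) ^ (-α) *
          ((minimiser (P.L ^ P.K) M (aK a P.L P.K) (((P.L ^ P.K : ℕ) : ℝ) ^ 2) m2 ψ xt
              - (((Finset.univ.filter fun x' : Tor (fine (P.L ^ n * P.L ^ P.K) M) =>
                    ∀ ν, (xt ν).val = (x' ν).val / P.L ^ n).card : ℝ))⁻¹ *
                ∑ x' ∈ (Finset.univ.filter fun x' : Tor (fine (P.L ^ n * P.L ^ P.K) M) =>
                    ∀ ν, (xt ν).val = (x' ν).val / P.L ^ n),
                  minimiser (P.L ^ n * P.L ^ P.K) M (aK a P.L (P.K + n)) (((P.L ^ n * P.L ^ P.K : ℕ) : ℝ) ^ 2) m2 ψ x')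
            - (minimiser (P.L ^ P.K) M (aK a P.L P.K) (((P.L ^ P.K : ℕ) : ℝ) ^ 2) m2 ψ (xt + v)
              - (((Finset.univ.filter fun y : Tor (fine (P.L ^ n * P.L ^ P.K) M) =>
                    ∀ ν, ((xt + v) ν).val = (y ν).val / P.L ^ n).card : ℝ))⁻¹ *
                ∑ y ∈ (Finset.univ.filter fun y : Tor (fine (P.L ^ n * P.L ^ P.K) M) =>
                    ∀ ν, ((xt + v) ν).val = (y ν).val / P.L ^ n),
                  minimiser (P.L ^ n * P.L ^ P.K) M (aK a P.L (P.K + n)) (((P.L ^ n * P.L ^ P.K : ℕ) : ℝ) ^ 2) m2 ψ y))|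
        ≤ 2 * Real.sqrt (2 * c *
              (fprop38RateConst a a (a * (2 * ((a * (1 - ((L : ℝ) ^ 2)⁻¹))⁻¹ + π ^ 2 / 48 + 1 / 3))) ((π ^ 2 / 4) ^ dd) dd γ α
                  (2 * (dd : ℝ) ^ α) 0
                + fprop38PosConst a ((π ^ 2 / 4) ^ dd) dd γ α (2 * (dd : ℝ) ^ α) (6 * (dd : ℝ) ^ (α + γ))))
            * latticeConst dd (δ / 2) * ((L : ℝ) ^ (-(γ / 2))) ^ P.K * S := by
  obtain ⟨δ, c, hδ, hc, HK⟩ := king_prop38_holder_torus_blocks dd L hd hLodd hL ha hm hα hγ hαγ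
  refine ⟨δ, c, hδ, hc, ?_⟩
  intro P hPd hPL hK _ n hn M _ hMK ψ S hS xt v
  subst hPd hPL
  -- elementary facts
  have hd0 : 0 < P.d := by omega
  have hS0 : 0 ≤ S := (abs_nonneg _).trans (hS 0)
  have hAC : 0 ≤ aliasConst P.d (α + γ - 1) := aliasConst_nonneg_of_lt_one hd0 (by linarith)
  have hCle := fprop38Const_le_unif (d := P.d) ha hL hK hn (V := (π ^ 2 / 4) ^ P.d) (γ := γ) (β := α)
    (cE := 2 * (P.d : ℝ) ^ α) (rE := 0) (sE := 6 * (P.d : ℝ) ^ (α + γ)) (by positivity) (by positivity) hAC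
  -- names: King's rate factor and the two decay profiles
  set Rk : ℝ := Real.sqrt ((fprop38RateConst a a (lemma43Const a P.L P.K n) ((π ^ 2 / 4) ^ P.d) P.d γ α (2 * (P.d : ℝ) ^ α) 0
      + fprop38PosConst a ((π ^ 2 / 4) ^ P.d) P.d γ α (2 * (P.d : ℝ) ^ α) (6 * (P.d : ℝ) ^ (α + γ)))
      * ((P.L ^ P.K : ℕ) : ℝ) ^ (-γ) * (2 * c)) with hRk
  have hRk0 : 0 ≤ Rk := Real.sqrt_nonneg _
  set E : Tor (fine (P.L ^ P.K) M) → Tor M → ℝ :=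
    fun z bt => Real.exp (-(δ / 2 * tdistT M (blockOf (P.L ^ P.K) M z) bt)) with hE
  have hE0 : ∀ z bt, 0 ≤ E z bt := fun z bt => (Real.exp_pos _).le
  -- the per-kernel bound `≤ Rk·(E xt bt + E (xt + v) bt)`
  have hker : ∀ bt : Tor M,
      |(holdist (P.L ^ P.K) M xt (xt + v)) ^ (-α) *
          ((minimiser (P.L ^ P.K) M (aK a P.L P.K) (((P.L ^ P.K : ℕ) : ℝ) ^ 2) m2 (Pi.single bt 1) xt
              - (((Finset.univ.filter fun x' : Tor (fine (P.L ^ n * P.L ^ P.K) M) =>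
                    ∀ ν, (xt ν).val = (x' ν).val / P.L ^ n).card : ℝ))⁻¹ *
                ∑ x' ∈ (Finset.univ.filter fun x' : Tor (fine (P.L ^ n * P.L ^ P.K) M) =>
                    ∀ ν, (xt ν).val = (x' ν).val / P.L ^ n),
                  minimiser (P.L ^ n * P.L ^ P.K) M (aK a P.L (P.K + n)) (((P.L ^ n * P.L ^ P.K : ℕ) : ℝ) ^ 2) m2
                    (Pi.single bt 1) x')
            - (minimiser (P.L ^ P.K) M (aK a P.L P.K) (((P.L ^ P.K : ℕ) : ℝ) ^ 2) m2 (Pi.single bt 1) (xt + v)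
              - (((Finset.univ.filter fun y : Tor (fine (P.L ^ n * P.L ^ P.K) M) =>
                    ∀ ν, ((xt + v) ν).val = (y ν).val / P.L ^ n).card : ℝ))⁻¹ *
                ∑ y ∈ (Finset.univ.filter fun y : Tor (fine (P.L ^ n * P.L ^ P.K) M) =>
                    ∀ ν, ((xt + v) ν).val = (y ν).val / P.L ^ n),
                  minimiser (P.L ^ n * P.L ^ P.K) M (aK a P.L (P.K + n)) (((P.L ^ n * P.L ^ P.K : ℕ) : ℝ) ^ 2) m2
                    (Pi.single bt 1) y))|
        ≤ Rk * (E xt bt + E (xt + v) bt) := by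
    intro bt
    have key := abs_blockMean_sub_le (overFib_nonempty (by omega) P.K n M xt)
      (f := fun x' : Tor (fine (P.L ^ n * P.L ^ P.K) M) => (holdist (P.L ^ P.K) M xt (xt + v)) ^ (-α) *
        (minimiser (P.L ^ n * P.L ^ P.K) M (aK a P.L (P.K + n)) (((P.L ^ n * P.L ^ P.K : ℕ) : ℝ) ^ 2) m2 (Pi.single bt 1) x'
          - minimiser (P.L ^ n * P.L ^ P.K) M (aK a P.L (P.K + n)) (((P.L ^ n * P.L ^ P.K : ℕ) : ℝ) ^ 2) m2 (Pi.single bt 1)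
            (x' + fun ν => (((v ν).val * P.L ^ n : ℕ) : ZMod (fine (P.L ^ n * P.L ^ P.K) M ν)))))
      (t := (holdist (P.L ^ P.K) M xt (xt + v)) ^ (-α) *
        (minimiser (P.L ^ P.K) M (aK a P.L P.K) (((P.L ^ P.K : ℕ) : ℝ) ^ 2) m2 (Pi.single bt 1) xt
          - minimiser (P.L ^ P.K) M (aK a P.L P.K) (((P.L ^ P.K : ℕ) : ℝ) ^ 2) m2 (Pi.single bt 1) (xt + v)))
      (C := Rk * (E xt bt + E (xt + v) bt))
      (fun x' hx' => by
        have hx := mem_overFib.1 hx'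
        have h := HK P rfl rfl hK n hn M hMK xt (xt + v) x' _ bt hx (over_add_translate xt x' hx v)
        rw [holdist_translate] at h
        exact h.trans (mul_le_mul_of_nonneg_left
          (exp_neg_mul_min_le (δ / 2) (tdistT M (blockOf (P.L ^ P.K) M xt) bt) (tdistT M (blockOf (P.L ^ P.K) M (xt + v)) bt))
          hRk0))
    rw [blockMean_mul_sub, abs_sub_comm] at key
    have hrew : ∀ w Ax Q0 Ay Q1 : ℝ, w * ((Ax - Q0) - (Ay - Q1)) = w * (Ax - Ay) - w * (Q0 - Q1) := by intros; ring
    rw [hrew, blockMean_translate xt v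
      (minimiser (P.L ^ n * P.L ^ P.K) M (aK a P.L (P.K + n)) (((P.L ^ n * P.L ^ P.K : ℕ) : ℝ) ^ 2) m2 (Pi.single bt 1))]
    exact key
  -- sum the two decay profiles over the unit torus
  have hsum : ∀ z : Tor (fine (P.L ^ P.K) M), ∑ bt : Tor M, E z bt ≤ latticeConst P.d (δ / 2) := fun z =>
    tdistT_sumBound M (δ / 2) (by positivity) (blockOf (P.L ^ P.K) M z)
  have hβsum : ∑ bt : Tor M, Rk * (E xt bt + E (xt + v) bt) ≤ Rk * (2 * latticeConst P.d (δ / 2)) := by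
    rw [← Finset.mul_sum, Finset.sum_add_distrib]
    have h0 := hsum xt; have h1 := hsum (xt + v)
    exact mul_le_mul_of_nonneg_left (by linarith) hRk0
  -- the uniform rate: `Rk ≤ √(2c·C₅″)·(L^{−γ∕2})^K`
  have hRk_le : Rk ≤ Real.sqrt (2 * c *
        (fprop38RateConst a a (a * (2 * ((a * (1 - ((P.L : ℝ) ^ 2)⁻¹))⁻¹ + π ^ 2 / 48 + 1 / 3))) ((π ^ 2 / 4) ^ P.d) P.d γ α
            (2 * (P.d : ℝ) ^ α) 0
          + fprop38PosConst a ((π ^ 2 / 4) ^ P.d) P.d γ α (2 * (P.d : ℝ) ^ α) (6 * (P.d : ℝ) ^ (α + γ))))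
      * ((P.L : ℝ) ^ (-(γ / 2))) ^ P.K :=
    sqrt_rate_le_unif hCle (by positivity) P.L P.K γ
  -- expand in the datum and sum
  rw [datum_expand]
  calc _ ≤ ∑ bt, |ψ bt * ((holdist (P.L ^ P.K) M xt (xt + v)) ^ (-α) *
          ((minimiser (P.L ^ P.K) M (aK a P.L P.K) (((P.L ^ P.K : ℕ) : ℝ) ^ 2) m2 (Pi.single bt 1) xt
              - (((Finset.univ.filter fun x' : Tor (fine (P.L ^ n * P.L ^ P.K) M) =>
                    ∀ ν, (xt ν).val = (x' ν).val / P.L ^ n).card : ℝ))⁻¹ *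
                ∑ x' ∈ (Finset.univ.filter fun x' : Tor (fine (P.L ^ n * P.L ^ P.K) M) =>
                    ∀ ν, (xt ν).val = (x' ν).val / P.L ^ n),
                  minimiser (P.L ^ n * P.L ^ P.K) M (aK a P.L (P.K + n)) (((P.L ^ n * P.L ^ P.K : ℕ) : ℝ) ^ 2) m2
                    (Pi.single bt 1) x')
            - (minimiser (P.L ^ P.K) M (aK a P.L P.K) (((P.L ^ P.K : ℕ) : ℝ) ^ 2) m2 (Pi.single bt 1) (xt + v)
              - (((Finset.univ.filter fun y : Tor (fine (P.L ^ n * P.L ^ P.K) M) =>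
                    ∀ ν, ((xt + v) ν).val = (y ν).val / P.L ^ n).card : ℝ))⁻¹ *
                ∑ y ∈ (Finset.univ.filter fun y : Tor (fine (P.L ^ n * P.L ^ P.K) M) =>
                    ∀ ν, ((xt + v) ν).val = (y ν).val / P.L ^ n),
                  minimiser (P.L ^ n * P.L ^ P.K) M (aK a P.L (P.K + n)) (((P.L ^ n * P.L ^ P.K : ℕ) : ℝ) ^ 2) m2
                    (Pi.single bt 1) y)))| := Finset.abs_sum_le_sum_abs _ _
    _ ≤ ∑ bt, S * (Rk * (E xt bt + E (xt + v) bt)) := by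
        refine Finset.sum_le_sum fun bt _ => ?_
        rw [abs_mul]
        exact mul_le_mul (hS bt) (hker bt) (abs_nonneg _) hS0
    _ = S * ∑ bt, Rk * (E xt bt + E (xt + v) bt) := by rw [Finset.mul_sum]
    _ ≤ S * (Rk * (2 * latticeConst P.d (δ / 2))) := mul_le_mul_of_nonneg_left hβsum hS0
    _ ≤ S * (Real.sqrt (2 * c *
          (fprop38RateConst a a (a * (2 * ((a * (1 - ((P.L : ℝ) ^ 2)⁻¹))⁻¹ + π ^ 2 / 48 + 1 / 3))) ((π ^ 2 / 4) ^ P.d) P.d γ α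
              (2 * (P.d : ℝ) ^ α) 0
            + fprop38PosConst a ((π ^ 2 / 4) ^ P.d) P.d γ α (2 * (P.d : ℝ) ^ α) (6 * (P.d : ℝ) ^ (α + γ))))
          * ((P.L : ℝ) ^ (-(γ / 2))) ^ P.K * (2 * latticeConst P.d (δ / 2))) := by
        have hK0 : 0 ≤ 2 * latticeConst P.d (δ / 2) := by
          have := latticeConst_nonneg P.d (by positivity : (0 : ℝ) ≤ δ / 2); linarith
        exact mul_le_mul_of_nonneg_left (mul_le_mul_of_nonneg_right hRk_le hK0) hS0
    _ = _ := by ring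

end Summit.QuantumFields.YangMills.BalabanUVNodes.N16KingModelHolder

end
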